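import Summits.ResolutionOfSingularities.ResolutionOfSingularities.Theorems.PurelyInseparableDim4StepKitF4
import Summits.ResolutionOfSingularities.ResolutionOfSingularities.Theorems.PurelyInseparableDim4ScopeBlindRationalMap
import Mathlib.Algebra.CharP.Two
import Mathlib.Data.ZMod.Basic
import HarnessLib

/-!
# STEP KIT over `𝔽₄`, part 2: the embeddings `F4 → L` into every field of characteristic `2`
# containing a primitive cube root of unity

[OURS · instrument · counted 0.]  Census cell «res-dim4-pi» (D-0157 DOOR 2), seat res-dim4-p-8 g3 (the finite-field
kernel lane ‖ K).  res-dim4-p-4's `…StepKitF4` gives the COMPUTABLE four-element field `StepKit.F4` (`0, 1, ω, ω+1`,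
`ω² = ω + 1`), over which `decide` evaluates the tree's certificate checkers.  To move a certificate computed over
`F4` to an ARBITRARY field `L` of characteristic `2` one needs a ring map `F4 →+* L`; it exists exactly when `L`
has a root `β` of `X² + X + 1`.  This file (the `𝔽₄` twin of `…StepKitF9` §2–3):

* §1 coordinates `re, im : F4 → ZMod 2` in the basis `(1, ω)` and their addition / multiplication tables;
* §2 **`F4.lift β hβ : F4 →+* L`** for `β ^ 2 + β + 1 = 0` (`a ↦ re a + im a · β`), `lift_om`, and
  **`castHom_eq_lift_comp_ι`**: the structure map `ZMod 2 → L` factors through `F4` (ring maps out of `ZMod 2`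
  are unique) — so an `𝔽₂`-state base-changed to `L` is the base change along `lift β hβ` of its `F4`-cast;
* §3 `SData.castF4` (an `𝔽₂`-presented state read over `F4`) and `castF4_toState_F`.

Nothing here proves or disproves resolution of singularities in dim ≥ 4 / char p.  bears_on:
LADDER-RESOLUTION:D157-DOOR2 (res-dim4-pi · ∀K column · instrument).  Supports stmt-ResolutionOfSingularities-16155
(helper).
-/

-- house layout `Summits/<Summit>/<Problem>` doubles the namespace component (as in the Target file)
set_option linter.dupNamespace false

namespace Summit.ResolutionOfSingularities.ResolutionOfSingularities.Theorems.PIDim4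

namespace StepKit

namespace F4

/-! ## 1. Coordinates in the basis `(1, ω)` -/

/-- the `1`-coordinate of an element of `F4` in the `𝔽₂`-basis `(1, ω)`. [folklore] -/
def re : F4 → ZMod 2
  | zero => 0 | one => 1 | om => 0 | om1 => 1

/-- the `ω`-coordinate of an element of `F4` in the `𝔽₂`-basis `(1, ω)`. [folklore] -/
def im : F4 → ZMod 2
  | zero => 0 | one => 0 | om => 1 | om1 => 1

/-- `re 0 = 0`. [folklore] -/ @[simp] theorem re_zero : re 0 = 0 := rfl
/-- `im 0 = 0`. [folklore] -/ @[simp] theorem im_zero : im 0 = 0 := rfl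
/-- `re 1 = 1`. [folklore] -/ @[simp] theorem re_one : re 1 = 1 := rfl
/-- `im 1 = 0`. [folklore] -/ @[simp] theorem im_one : im 1 = 0 := rfl
/-- `re ω = 0`. [folklore] -/ @[simp] theorem re_om : re om = 0 := rfl
/-- `im ω = 1`. [folklore] -/ @[simp] theorem im_om : im om = 1 := rfl
/-- `re (ω+1) = 1`. [folklore] -/ @[simp] theorem re_om1 : re om1 = 1 := rfl
/-- `im (ω+1) = 1`. [folklore] -/ @[simp] theorem im_om1 : im om1 = 1 := rfl

/-- coordinates are additive. [folklore] -/
theorem re_add (a b : F4) : re (a + b) = re a + re b := by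
  cases a <;> cases b <;> decide

/-- coordinates are additive. [folklore] -/
theorem im_add (a b : F4) : im (a + b) = im a + im b := by
  cases a <;> cases b <;> decide

/-- multiplication table in coordinates (`ω² = ω + 1`): the `1`-part. [folklore] -/
theorem re_mul (a b : F4) : re (a * b) = re a * re b + im a * im b := by
  cases a <;> cases b <;> decide

/-- multiplication table in coordinates (`ω² = ω + 1`): the `ω`-part. [folklore] -/
theorem im_mul (a b : F4) : im (a * b) = re a * im b + im a * re b + im a * im b := by
  cases a <;> cases b <;> decide

/-- the structure map `ZMod 2 → F4`, as a table (so that `decide` evaluates it instantly). [folklore] -/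
def ι : ZMod 2 →+* F4 where
  toFun a := if a = 0 then 0 else 1
  map_one' := by decide
  map_mul' := by decide
  map_zero' := by decide
  map_add' := by decide

/-- `ι` IS the structure map (ring maps out of `ZMod 2` are unique). [folklore] -/
theorem ι_eq_castHom : ι = ZMod.castHom (dvd_refl 2) F4 := Subsingleton.elim _ _

/-! ## 2. The lift `F4 → L` along a root of `X² + X + 1` -/

section Lift

variable {L : Type} [CommRing L] [CharP L 2]

/-- in characteristic `2`, `β² + β + 1 = 0` reads `β² = β + 1`. [folklore] -/
theorem sq_eq_of_root (β : L) (hβ : β ^ 2 + β + 1 = 0) : β ^ 2 = β + 1 := by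
  linear_combination hβ - (β + 1) * (CharTwo.two_eq_zero (R := L))

/-- **`F4.lift β hβ : F4 →+* L`**, `a ↦ re a + im a · β`, for a root `β` of `X² + X + 1` in a ring of
characteristic `2` (so `ω ↦ β`). [folklore] -/
def lift (β : L) (hβ : β ^ 2 + β + 1 = 0) : F4 →+* L where
  toFun a := ZMod.castHom (dvd_refl 2) L (re a) + ZMod.castHom (dvd_refl 2) L (im a) * β
  map_one' := by simp
  map_mul' a b := by
    simp only [re_mul, im_mul, map_mul, map_add]
    linear_combination (-(ZMod.castHom (dvd_refl 2) L (im a) * ZMod.castHom (dvd_refl 2) L (im b))) *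
      sq_eq_of_root β hβ
  map_zero' := by simp
  map_add' a b := by
    simp only [re_add, im_add, map_add]
    ring

/-- `lift β hβ` in coordinates. [folklore] -/
theorem lift_apply (β : L) (hβ : β ^ 2 + β + 1 = 0) (a : F4) :
    lift β hβ a = ZMod.castHom (dvd_refl 2) L (re a) + ZMod.castHom (dvd_refl 2) L (im a) * β := rfl

/-- `lift β hβ ω = β`. [folklore] -/
@[simp] theorem lift_om (β : L) (hβ : β ^ 2 + β + 1 = 0) : lift β hβ om = β := by
  simp [lift_apply]

/-- `lift β hβ (ω + 1) = β + 1`. [folklore] -/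
@[simp] theorem lift_om1 (β : L) (hβ : β ^ 2 + β + 1 = 0) : lift β hβ om1 = β + 1 := by
  simp [lift_apply, add_comm]

/-- `lift β hβ` extends the structure map: `lift ∘ ι = (ZMod 2 → L)`. [folklore] -/
theorem lift_comp_ι (β : L) (hβ : β ^ 2 + β + 1 = 0) : (lift β hβ).comp ι = ZMod.castHom (dvd_refl 2) L :=
  Subsingleton.elim _ _

/-- **The structure map `ZMod 2 → L` factors through `F4`** (ring maps out of `ZMod 2` are unique). [folklore] -/
theorem castHom_eq_lift_comp_ι (β : L) (hβ : β ^ 2 + β + 1 = 0) :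
    ZMod.castHom (dvd_refl 2) L = (lift β hβ).comp ι :=
  Subsingleton.elim _ _

/-- the other root: if `β² + β + 1 = 0` then `(β²)² + β² + 1 = 0` as well (Frobenius). [folklore] -/
theorem root_sq (β : L) (hβ : β ^ 2 + β + 1 = 0) : (β ^ 2) ^ 2 + β ^ 2 + 1 = 0 := by
  rw [sq_eq_of_root β hβ]
  linear_combination hβ + (β + 1) * (CharTwo.two_eq_zero (R := L))

/-- and `β² = β + 1` is that other root written linearly. [folklore] -/
theorem root_add_one (β : L) (hβ : β ^ 2 + β + 1 = 0) : (β + 1) ^ 2 + (β + 1) + 1 = 0 := by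
  rw [← sq_eq_of_root β hβ]; exact root_sq β hβ

end Lift

end F4

/-! ## 3. `𝔽₂`-presented states read over `F4` -/

section MapCoeffs

variable {n : ℕ}

/-- an `𝔽₂`-presented state read over `F4` (coefficients through `ι`). [folklore] -/
def SData.castF4 (s : SData n (ZMod 2)) : SData n F4 := ⟨s.L.map fun t => (t.1, F4.ι t.2), s.r, s.exc⟩

/-- the polynomial of the cast state is the base change along `ι`. [folklore] -/
theorem SData.castF4_toState_F (s : SData n (ZMod 2)) :
    s.castF4.toState.F = MvPolynomial.map F4.ι s.toState.F := by
  rw [SData.toState_F, SData.toState_F, map_evalT]; rfl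

/-- decorations are unchanged. [folklore] -/
theorem SData.castF4_toState_r (s : SData n (ZMod 2)) : s.castF4.toState.r = s.toState.r := rfl

/-- decorations are unchanged. [folklore] -/
theorem SData.castF4_toState_exc (s : SData n (ZMod 2)) : s.castF4.toState.exc = s.toState.exc := rfl

/-- `castF4` commutes with `chartL` up to the coefficient map (both are `List.map`s on exponents / coefficients).
[folklore] -/
theorem SData.castF4_L (s : SData n (ZMod 2)) : s.castF4.L = s.L.map fun t => (t.1, F4.ι t.2) := rfl

/-- **every `𝔽₂`-state base-changed to a field `L` with a root `β` of `X² + X + 1` is the base change along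
`F4.lift β hβ` of its `F4`-cast.** [folklore] -/
theorem SData.map_castHom_eq_map_lift_castF4 {L : Type} [CommRing L] [CharP L 2] (s : SData n (ZMod 2)) (β : L)
    (hβ : β ^ 2 + β + 1 = 0) :
    MvPolynomial.map (ZMod.castHom (dvd_refl 2) L) s.toState.F = MvPolynomial.map (F4.lift β hβ) s.castF4.toState.F := by
  rw [SData.castF4_toState_F, MvPolynomial.map_map, ← F4.castHom_eq_lift_comp_ι β hβ]

end MapCoeffs

/-! ## 4. Acceptance: a handful of table entries by `decide` -/

namespace F4

/-- `ω·(ω+1) = 1`, `ω³ = 1`, `ω⁻¹ = ω + 1`, `re/im` of `ω·ω`. [folklore] -/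
theorem tables_spot_check :
    om * om1 = 1 ∧ om ^ 3 = 1 ∧ om⁻¹ = om1 ∧ re (om * om) = 1 ∧ im (om * om) = 1 := by
  decide

end F4

end StepKit

end Summit.ResolutionOfSingularities.ResolutionOfSingularities.Theorems.PIDim4
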